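import Literature.Analysis.TotalPositivity.PolyaFrequencyJensenRoots
import Literature.Analysis.TotalPositivity.PolyaFrequencyProductLimit
import Literature.Analysis.TotalPositivity.PolyaFrequencyZeros
import Mathlib.Analysis.Complex.Liouville
import Mathlib.Analysis.Normed.Group.Tannery
import HarnessLib

/-!
# The Pólya–Schur / Laguerre–Pólya theorem for real-rooted Jensen polynomials (Schoenberg 1951,
necessity half, step N4d)

Trunk `Literature/Analysis/TotalPositivity`, eighteenth proofs file accompanying
`PolyaFrequencyFunctions.lean` (the named fact `schoenberg1951_pf_laplace`).  Let `γ : ℕ → ℝ`,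
`γ₀ = 1`, be such that every reversed Jensen polynomial `Σ_{k≤n} γ_k H_k(X^n)` has `n` real roots.
Then the power series `Σ_k γ_k z^k / k!` converges on all of `ℂ` to an entire function of the
Laguerre–Pólya form

> `Σ_k γ_k z^k/k! = exp(γ_1 z − κ z²/2) ∏_i (1 + δ_i z) e^{−δ_i z}`, `κ ≥ 0`, `δ_i ∈ ℝ`, `Σ δ_i² < ∞`

(`exists_hasSum_of_realRooted`).  Proof (Pólya–Schur): with the linear factors of
PolyaFrequencyJensenRoots.lean, `P_n(z) = ∏_i (1 + a_{n,i} z) = e^{γ_1 z} ∏_i E(a_{n,i} z)` has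
coefficients `C(n,k) γ_k n^{-k} → γ_k/k!` and `‖P_n(z)‖ ≤ exp(|γ_1| ‖z‖ + B' ‖z‖²/2)`; Cauchy's
estimate makes the coefficients uniformly dominated, so `P_n → Σ γ_k z^k/k!` pointwise (Tannery);
along a diagonal subsequence of the `|·|`-sorted root configurations
(PolyaFrequencyRootCompactness.lean) the products converge to the displayed Laguerre–Pólya product
(PolyaFrequencyProductLimit.lean). [Schoenberg1951, §9; Pólya–Schur 1914]

## References

* I. J. Schoenberg, *On Pólya frequency functions. I*, J. Analyse Math. 1 (1951) 331–374, §9.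
  [Schoenberg1951]
* G. Pólya, I. Schur, *Über zwei Arten von Faktorenfolgen in der Theorie der algebraischen
  Gleichungen*, J. reine angew. Math. 144 (1914) 89–113. [folklore]
-/

noncomputable section

open Filter Set Finset Complex Polynomial
open scoped Topology Polynomial

namespace Literature.Analysis.TotalPositivity

/-! ### `C(m,k)/m^k → 1/k!` -/

/-- `C(m,k) m^{-k} → 1/k!` as `m → ∞`. [folklore] -/
theorem tendsto_choose_div_pow (k : ℕ) :
    Tendsto (fun m : ℕ => (m.choose k : ℝ) / (m : ℝ) ^ k) atTop (𝓝 (1 / (k.factorial : ℝ))) := by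
  have h1 : Tendsto (fun m : ℕ => (1 / (k.factorial : ℝ)) * ∏ i ∈ Finset.range k, (1 - (i : ℝ) / m))
      atTop (𝓝 ((1 / (k.factorial : ℝ)) * ∏ i ∈ Finset.range k, (1 - 0))) := by
    refine Tendsto.const_mul _ (tendsto_finsetProd _ fun i _ => ?_)
    exact tendsto_const_nhds.sub (tendsto_const_nhds.div_atTop tendsto_natCast_atTop_atTop)
  simp only [sub_zero, Finset.prod_const_one, mul_one] at h1
  refine h1.congr' ?_
  filter_upwards [eventually_ge_atTop k, eventually_gt_atTop 0] with m hm hm0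
  have hm0' : (m : ℝ) ≠ 0 := by
    have : (0 : ℝ) < m := by exact_mod_cast hm0
    exact this.ne'
  have hdesc : (k.factorial : ℝ) * (m.choose k : ℝ) = ∏ i ∈ Finset.range k, ((m : ℝ) - i) := by
    have h := Nat.descFactorial_eq_factorial_mul_choose m k
    rw [Nat.descFactorial_eq_prod_range] at h
    have h' := congrArg (Nat.cast (R := ℝ)) h
    rw [Nat.cast_prod, Nat.cast_mul] at h'
    rw [← h']
    refine Finset.prod_congr rfl fun i hi => ?_
    simp only [Finset.mem_range] at hi
    rw [Nat.cast_sub (by omega)]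
  have hprod : ∏ i ∈ Finset.range k, (1 - (i : ℝ) / m) =
      (∏ i ∈ Finset.range k, ((m : ℝ) - i)) / (m : ℝ) ^ k := by
    rw [eq_div_iff (pow_ne_zero _ hm0'),
      show (m : ℝ) ^ k = ∏ _i ∈ Finset.range k, (m : ℝ) by simp, ← Finset.prod_mul_distrib]
    exact Finset.prod_congr rfl fun i _ => by field_simp
  rw [hprod, ← hdesc]
  have hk : (k.factorial : ℝ) ≠ 0 := by exact_mod_cast k.factorial_ne_zero
  field_simp

/-! ### Cauchy's estimate for polynomial coefficients -/

/-- **Cauchy's estimate** for the coefficients of a polynomial bounded by `M` on `‖z‖ = R`.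
[folklore] -/
theorem norm_coeff_le_of_bound {e : ℕ → ℂ} {m : ℕ} (he : ∀ k, m < k → e k = 0) {R M : ℝ}
    (hR : 0 < R) (hM : ∀ z : ℂ, ‖z‖ = R → ‖∑ k ∈ Finset.range (m + 1), e k * z ^ k‖ ≤ M) (k : ℕ) :
    ‖e k‖ ≤ M / R ^ k := by
  set h : ℂ → ℂ := fun z => ∑ k ∈ Finset.range (m + 1), e k * z ^ k with hh
  have hsum : ∀ z : ℂ, ‖z‖ < R + 1 → HasSum (fun k => e k * z ^ k) (h z) := fun z _ =>
    hasSum_sum_of_ne_finset_zero fun k hk => by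
      rw [he k (by simpa using hk), zero_mul]
  have hder := iteratedDeriv_eq_of_hasSum (by linarith) hsum k
  have hdiff : DiffContOnCl ℂ h (Metric.ball 0 R) := by
    refine Differentiable.diffContOnCl ?_
    simp only [hh]
    fun_prop
  have hC := Complex.norm_iteratedDeriv_le_of_forall_mem_sphere_norm_le k hR hdiff
    (fun z hz => hM z (by simpa using hz))
  rw [hder, norm_mul, Complex.norm_natCast] at hC
  have hk : (0 : ℝ) < k.factorial := by exact_mod_cast k.factorial_pos
  have h2 : (k.factorial : ℝ) * ‖e k‖ ≤ (k.factorial : ℝ) * (M / R ^ k) := by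
    rw [mul_div_assoc] at hC
    exact hC
  exact le_of_mul_le_mul_left h2 hk

/-! ### From linear factors to `E`-factors -/

/-- `∏ (1 + a_i z) = exp((Σ a_i) z) ∏ (1 + a_i z) e^{−a_i z}`. [folklore] -/
theorem prod_one_add_eq_exp_mul_prod {ι : Type*} (s : Finset ι) (a : ι → ℝ) (z : ℂ) :
    ∏ i ∈ s, (1 + (a i : ℂ) * z) =
      cexp (((∑ i ∈ s, a i : ℝ) : ℂ) * z) * ∏ i ∈ s, (1 + (a i : ℂ) * z) * cexp (-((a i : ℂ) * z)) := by
  rw [Finset.prod_mul_distrib, ← Complex.exp_sum, mul_left_comm, ← Complex.exp_add,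
    Complex.ofReal_sum, Finset.sum_mul, ← Finset.sum_add_distrib]
  simp

/-! ### The theorem -/

/-- **Pólya–Schur / Laguerre–Pólya for real-rooted Jensen polynomials.** If `γ₀ = 1` and every
reversed Jensen polynomial `Σ_{k≤n} γ_k H_k(X^n)` has `n` real roots, then there are `κ ≥ 0` and a
real square-summable sequence `δ` with
`Σ_k (γ_k/k!) z^k = exp(γ_1 z − κ z²/2) ∏_i (1 + δ_i z) e^{−δ_i z}` for every complex `z` (the
series converging). [cite: Schoenberg1951, §9] -/
theorem exists_hasSum_of_realRooted {γ : ℕ → ℝ} (hγ0 : γ 0 = 1)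
    (hreal : ∀ n, Multiset.card
      (∑ k ∈ Finset.range (n + 1), γ k • hasseDeriv k (X ^ n : ℝ[X])).roots = n) :
    ∃ (κ : ℝ) (δ : ℕ → ℝ), 0 ≤ κ ∧ Summable (fun i => δ i ^ 2) ∧
      ∀ z : ℂ, HasSum (fun k => ((γ k / k.factorial : ℝ) : ℂ) * z ^ k)
        (cexp ((γ 1 : ℂ) * z - (κ : ℂ) * z ^ 2 / 2) *
          ∏' i, (1 + (δ i : ℂ) * z) * cexp (-((δ i : ℂ) * z))) := by
  classical
  -- the rows of linear factors (row `n` has `n + 1` entries)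
  have hA := fun n : ℕ => exists_linear_factors hγ0 (Nat.succ_pos n) (hreal (n + 1))
  choose A hAprod hAsum hAsq using hA
  have hσ := fun n => exists_perm_antitone_abs (A n)
  choose σ hσ using hσ
  set b : ℕ → ℕ → ℝ := fun n i => if h : i < n + 1 then A n (σ n ⟨i, h⟩) else 0 with hb
  set B' : ℝ := γ 1 ^ 2 + |γ 2| with hB'
  set Bn : ℕ → ℝ := fun n => γ 1 ^ 2 - (1 - 1 / ((n : ℝ) + 1)) * γ 2 with hBn
  have hzero : ∀ n i, n + 1 ≤ i → b n i = 0 := fun n i hi => by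
    simp only [hb]
    exact dif_neg (by omega)
  have hanti : ∀ n, Antitone fun i => |b n i| := fun n => antitone_abs_pad (hσ n)
  have hsumb : ∀ n, ∑ i ∈ Finset.range (n + 1), b n i = γ 1 := by
    intro n
    rw [hb]
    rw [sum_pad_eq (fun i => A n (σ n i)) (fun x => x), Equiv.sum_comp (σ n) (fun i => A n i)]
    exact hAsum n
  have hsumsq : ∀ n, ∑ i ∈ Finset.range (n + 1), b n i ^ 2 = Bn n := by
    intro n
    rw [hb]
    rw [sum_pad_eq (fun i => A n (σ n i)) (fun x => x ^ 2),
      Equiv.sum_comp (σ n) (fun i => A n i ^ 2), hAsq n]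
    simp only [hBn]
    push_cast
    ring
  have hBn_le : ∀ n, Bn n ≤ B' := by
    intro n
    simp only [hBn, hB']
    have h1 : (0 : ℝ) ≤ 1 - 1 / ((n : ℝ) + 1) := by
      rw [sub_nonneg, div_le_one (by positivity)]
      linarith [(Nat.cast_nonneg n : (0 : ℝ) ≤ n)]
    have h2 : 1 - 1 / ((n : ℝ) + 1) ≤ 1 := by
      have : (0 : ℝ) ≤ 1 / ((n : ℝ) + 1) := by positivity
      linarith
    have h3 : |(1 - 1 / ((n : ℝ) + 1)) * γ 2| ≤ |γ 2| := by
      rw [abs_mul, abs_of_nonneg h1]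
      exact mul_le_of_le_one_left (abs_nonneg _) h2
    linarith [neg_abs_le ((1 - 1 / ((n : ℝ) + 1)) * γ 2)]
  have hbound : ∀ n, ∑ i ∈ Finset.range (n + 1), b n i ^ 2 ≤ B' := fun n =>
    (hsumsq n).le.trans (hBn_le n)
  have hbabs : ∀ n i, |b n i| ≤ Real.sqrt B' := fun n i =>
    abs_le_sqrt_of_sum_sq_le (hbound n) (hzero n) i
  -- diagonal subsequence
  obtain ⟨φ, δ, hφ, hlim⟩ := exists_diagonal_subseq hbabs
  have hφ' : Tendsto (fun l => φ l + 1) atTop atTop := (hφ.add_const 1).tendsto_atTop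
  have hBn_lim : Tendsto Bn atTop (𝓝 (γ 1 ^ 2 - γ 2)) := by
    have h1 : Tendsto (fun n : ℕ => 1 - 1 / ((n : ℝ) + 1)) atTop (𝓝 (1 - 0)) :=
      tendsto_const_nhds.sub tendsto_one_div_add_atTop_nhds_zero_nat
    have h2 := tendsto_const_nhds (x := γ 1 ^ 2) |>.sub ((h1.mul_const (γ 2)))
    simpa [hBn] using h2
  have hB : Tendsto (fun l => ∑ i ∈ Finset.range (φ l + 1), b (φ l) i ^ 2) atTop
      (𝓝 (γ 1 ^ 2 - γ 2)) := by
    simp only [hsumsq]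
    exact hBn_lim.comp hφ.tendsto_atTop
  obtain ⟨hδ, hδB⟩ := summable_sq_of_tendsto (x := fun l => b (φ l)) (N := fun l => φ l + 1)
    hlim (fun l i h => hzero _ _ h) hB
  set κ : ℝ := γ 1 ^ 2 - γ 2 - ∑' i, δ i ^ 2 with hκ
  have hκ0 : 0 ≤ κ := by simp only [hκ]; linarith
  have hrows : ∀ z : ℂ, Tendsto (fun l => ∏ i ∈ Finset.range (φ l + 1),
      (1 + (b (φ l) i : ℂ) * z) * cexp (-((b (φ l) i : ℂ) * z))) atTop
      (𝓝 (cexp (-((κ : ℂ) * z ^ 2 / 2)) * ∏' i, (1 + (δ i : ℂ) * z) * cexp (-((δ i : ℂ) * z)))) :=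
    fun z => tendsto_prod_linExp_rows (b := fun l => b (φ l)) (N := fun l => φ l + 1)
      (fun l i h => hzero _ _ h) (fun l => hanti _) (fun l => hbound _) hlim hB z
  -- the polynomials `P_n`
  set e : ℕ → ℕ → ℝ := fun m k => (m.choose k : ℝ) * γ k / (m : ℝ) ^ k with he
  set P : ℕ → ℂ → ℂ := fun n z => ∏ i, (1 + (A n i : ℂ) * z) with hP
  have hPsum : ∀ n z, P n z = ∑ k ∈ Finset.range (n + 1 + 1), ((e (n + 1) k : ℝ) : ℂ) * z ^ k :=
    fun n z => hAprod n z
  have hPprod : ∀ n z, P n z = cexp ((γ 1 : ℂ) * z) * ∏ i ∈ Finset.range (n + 1),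
      (1 + (b n i : ℂ) * z) * cexp (-((b n i : ℂ) * z)) := by
    intro n z
    have h1 : P n z = ∏ i ∈ Finset.range (n + 1), (1 + (b n i : ℂ) * z) := by
      simp only [hP]
      rw [hb, prod_pad_eq (fun i => A n (σ n i)) (fun x => 1 + (x : ℂ) * z),
        Equiv.prod_comp (σ n) (fun i => 1 + (A n i : ℂ) * z)]
    rw [h1, prod_one_add_eq_exp_mul_prod, hsumb n]
  have hPlim : ∀ z, Tendsto (fun l => P (φ l) z) atTop
      (𝓝 (cexp ((γ 1 : ℂ) * z) * (cexp (-((κ : ℂ) * z ^ 2 / 2)) *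
        ∏' i, (1 + (δ i : ℂ) * z) * cexp (-((δ i : ℂ) * z))))) := by
    intro z
    simp only [hPprod]
    exact (hrows z).const_mul _
  have hPbound : ∀ n z, ‖P n z‖ ≤ Real.exp (|γ 1| * ‖z‖ + B' * ‖z‖ ^ 2 / 2) := by
    intro n z
    rw [hPprod, norm_mul, Real.exp_add]
    refine mul_le_mul ?_ ?_ (norm_nonneg _) (Real.exp_pos _).le
    · rw [Complex.norm_exp]
      refine Real.exp_le_exp.2 ((Complex.re_le_norm _).trans ?_)
      rw [norm_mul, Complex.norm_real, Real.norm_eq_abs]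
    · calc ‖∏ i ∈ Finset.range (n + 1), (1 + (b n i : ℂ) * z) * cexp (-((b n i : ℂ) * z))‖
          ≤ ∏ i ∈ Finset.range (n + 1), ‖(1 + (b n i : ℂ) * z) * cexp (-((b n i : ℂ) * z))‖ :=
            Finset.norm_prod_le _ _
        _ ≤ ∏ i ∈ Finset.range (n + 1), Real.exp (b n i ^ 2 * ‖z‖ ^ 2 / 2) := by
            refine Finset.prod_le_prod (fun i _ => norm_nonneg _) fun i _ => ?_
            refine (norm_linExp_le _).trans ?_
            rw [norm_mul, Complex.norm_real, Real.norm_eq_abs, mul_pow, sq_abs]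
        _ = Real.exp ((∑ i ∈ Finset.range (n + 1), b n i ^ 2) * ‖z‖ ^ 2 / 2) := by
            rw [← Real.exp_sum, Finset.sum_mul, Finset.sum_div]
        _ ≤ Real.exp (B' * ‖z‖ ^ 2 / 2) := by
            refine Real.exp_le_exp.2 ?_
            gcongr
            exact hbound n
  -- Cauchy's estimate: uniform domination of the coefficients
  have hcoef : ∀ n k (R : ℝ), 0 < R →
      |e (n + 1) k| ≤ Real.exp (|γ 1| * R + B' * R ^ 2 / 2) / R ^ k := by
    intro n k R hR
    have h := norm_coeff_le_of_bound (e := fun k => ((e (n + 1) k : ℝ) : ℂ)) (m := n + 1)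
      (M := Real.exp (|γ 1| * R + B' * R ^ 2 / 2))
      (fun k hk => by
        simp only [he, Nat.choose_eq_zero_of_lt hk, Nat.cast_zero, zero_mul, zero_div,
          Complex.ofReal_zero]) hR
      (fun z hz => by rw [← hPsum n z, ← hz]; exact hPbound n z) k
    rwa [Complex.norm_real, Real.norm_eq_abs] at h
  -- coefficient limits
  have he_lim : ∀ k, Tendsto (fun l => e (φ l + 1) k) atTop (𝓝 (γ k / k.factorial)) := by
    intro k
    have h1 := (tendsto_choose_div_pow k).comp hφ'
    have h2 := h1.const_mul (γ k)
    rw [show γ k * (1 / (k.factorial : ℝ)) = γ k / k.factorial by ring] at h2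
    refine h2.congr fun l => ?_
    simp only [he, Function.comp_apply]
    ring
  -- conclusion, by Tannery's theorem at each `z`
  refine ⟨κ, δ, hκ0, hδ, fun z => ?_⟩
  set R : ℝ := 2 * ‖z‖ + 1 with hR
  have hR0 : 0 < R := by positivity
  set M : ℝ := Real.exp (|γ 1| * R + B' * R ^ 2 / 2) with hM
  have hr1 : ‖z‖ / R < 1 := by
    rw [div_lt_one hR0, hR]
    linarith [norm_nonneg z]
  have hr0 : 0 ≤ ‖z‖ / R := by positivity
  have hbsum : Summable fun k : ℕ => M * (‖z‖ / R) ^ k :=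
    (summable_geometric_of_lt_one hr0 hr1).mul_left M
  have hfb : ∀ l k, ‖((e (φ l + 1) k : ℝ) : ℂ) * z ^ k‖ ≤ M * (‖z‖ / R) ^ k := by
    intro l k
    rw [norm_mul, Complex.norm_real, Real.norm_eq_abs, norm_pow, div_pow, ← mul_div_assoc,
      mul_div_right_comm]
    exact mul_le_mul_of_nonneg_right (hcoef _ k R hR0) (pow_nonneg (norm_nonneg _) _)
  have hT := tendsto_tsum_of_dominated_convergence (𝓕 := atTop)
    (f := fun l k => ((e (φ l + 1) k : ℝ) : ℂ) * z ^ k)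
    (g := fun k => ((γ k / k.factorial : ℝ) : ℂ) * z ^ k) hbsum
    (fun k => ((Complex.continuous_ofReal.tendsto _).comp (he_lim k)).mul_const _)
    (Eventually.of_forall hfb)
  have htsum : ∀ l, ∑' k, ((e (φ l + 1) k : ℝ) : ℂ) * z ^ k = P (φ l) z := by
    intro l
    rw [hPsum, tsum_eq_sum]
    intro k hk
    simp only [Finset.mem_range, not_lt] at hk
    simp only [he, Nat.choose_eq_zero_of_lt (by omega : φ l + 1 < k), Nat.cast_zero, zero_mul,
      zero_div, Complex.ofReal_zero]
  simp only [htsum] at hT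
  have hlimeq := tendsto_nhds_unique hT (hPlim z)
  -- summability of the limit series
  have hgb : ∀ k, ‖((γ k / k.factorial : ℝ) : ℂ) * z ^ k‖ ≤ M * (‖z‖ / R) ^ k := by
    intro k
    have h1 : |γ k / k.factorial| ≤ M / R ^ k :=
      le_of_tendsto' ((he_lim k).abs) fun l => hcoef _ k R hR0
    rw [norm_mul, Complex.norm_real, Real.norm_eq_abs, norm_pow, div_pow, ← mul_div_assoc,
      mul_div_right_comm]
    exact mul_le_mul_of_nonneg_right h1 (pow_nonneg (norm_nonneg _) _)
  have hgs : Summable fun k => ((γ k / k.factorial : ℝ) : ℂ) * z ^ k :=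
    Summable.of_norm_bounded hbsum hgb
  have := hgs.hasSum
  rw [hlimeq, ← mul_assoc, ← Complex.exp_add] at this
  convert this using 3
  ring

end Literature.Analysis.TotalPositivity
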